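import Literature.NumberTheory.EllipticCurves.FineSelmerCoefficientMapProofs
import Literature.NumberTheory.EllipticCurves.SubgroupSelmerCocycleCriteriaProofs
import Literature.NumberTheory.GaloisRepresentations.AbsGaloisGroupCompact
import Mathlib.Topology.Algebra.ClopenNhdofOne
import Mathlib.GroupTheory.Index
import HarnessLib

/-!
# The residual fine Selmer group `Sel₀(K_∞, M)` read on `Gal(K̄/L_∞)`: shadows of fine classes are
# everywhere-locally-trivial characters (Coates–Sujatha 2005, proof of Thm. 3.4, first half) — PROVED

Topic `NumberTheory/EllipticCurves` (namespace = path, grouping sub-namespace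
`FineSelmerResidualCharacter`).  THEOREM-ONLY file (no definition, no named fact, no `sorry`), written
by the literature seat `bsd-potss-conjA-anchor` g17 (cell `bsd-potss`; serves the asides
stmt-BirchSwinnertonDyer-19386 / 19413; closes nothing; neither Conjecture A nor BSD is proved here).

## Setting and content

`K` a number field, `κ : Γ_K ↠ ℤ_p` a `ℤ_p`-extension (`H = ker κ = Gal(K̄/K_∞)`), `M` a finite
discrete `Γ_K`-module, `Λ₀ ⊴ Γ_K` an open normal subgroup acting trivially on `M` (`Λ₀ = Gal(K̄/L)`,
`L ⊇ K(M)`), `H′ = Λ₀ ∩ H = Gal(K̄/L_∞)`.  Coates–Sujatha (Math. Ann. 331 (2005) §3, proof of Thm. 3.4)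
read the residual fine Selmer group `R(E[p]/F_∞)` through the restriction
`H¹(F_∞, E[p]) → H¹(L_∞, E[p]) = Hom(Gal(F̄/L_∞), E[p])`, whose kernel `H¹(Gal(L_∞/F_∞), E[p])` is
finite and whose image consists of homomorphisms trivial on every decomposition group.  This file
proves that dictionary for the tree's `GreenbergSelmer.fineSelmerInfty M κ` at the level of explicit
continuous cocycles (`contOneCocycles`, `oneCocycleClass`).  A «SHADOW» of a class `c ∈ Sel₀(K_∞, M)`
is a function `f : Γ_K → M` vanishing off `H′` and agreeing on `H′` with a continuous cocycle `z` of `H`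
representing `c` (all cocycles of `c` agree on `H′`, where the action is trivial); the predicate is
spelled out in each statement (no definition is introduced).

* §1 cocycle algebra on a subgroup (`apply_mul'`, conjugation formula).
* §2 shadows form a `Γ_K`-stable subgroup of `Γ_K → M` under `(g ⋆ f)(τ) = g • f(g⁻¹τg)`
  (`shadow_add`, `shadow_neg`, `shadow_conj`), on which `H` acts trivially (`conj_eq_self_of_mem_ker`),
  every shadow is additive and kills `H′ ∩ gD_vg⁻¹` for every finite place `v` and `g ∈ Γ_K`
  (`shadow_eq_zero_of_conj_mem_decomp` — the fine local conditions), and has an OPEN stabiliser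
  (`exists_openNormal_conj_eq_self`).
* §3 `finite_setOf_invisible` — the classes all of whose cocycles vanish on `H′` form a FINITE set
  (they are inflated from the finite `H/H′` with values in the finite `M`); hence
  `exists_shadow_ne_zero`: if `Sel₀(K_∞, M)` is infinite, some class has a non-zero shadow.

The sequel `FineSelmerResidualCharacterFixed.lean` produces a `Γ_K`-INVARIANT non-zero shadow (pro-`p`
fixed point) — a non-zero `Γ_K`-equivariant everywhere-unramified character of `Gal(K̄/L_∞)` — the input
of the equivariant descent `NumberFields/EquivariantUnramifiedDescent.lean`.

## References

* J. Coates, R. Sujatha, *Fine Selmer groups of elliptic curves over `p`-adic Lie extensions*,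
  Math. Ann. 331 (2005), §3, Thm. 3.4 and its proof, Lemma 3.8. [CoatesSujatha2005]
* J.-P. Serre, *Galois Cohomology* (1997), I §2.2–2.5, I §5.1 (cocycles, restriction, conjugation,
  `H¹` of a profinite group as a direct limit). [SerreGaloisCohomology1997]
* R. Greenberg, Adv. Stud. Pure Math. 17 (1989), §1 p. 98 (the strict local conditions). [Greenberg1989]
-/

noncomputable section

open scoped Classical Pointwise

universe u

namespace Literature.NumberTheory.EllipticCurves.FineSelmerResidualCharacter

open NumberField IsDedekindDomain Field
open Literature.NumberTheory.EllipticCurves Literature.NumberTheory.EllipticCurves.GreenbergSelmer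
  Literature.NumberTheory.EllipticCurves.CocycleCriteria Literature.NumberTheory.GaloisRepresentations

/-! ## §1 Cocycle algebra on a subgroup -/

section Cocycle

variable {G : Type u} [Group G] [TopologicalSpace G] [IsTopologicalGroup G]
  {M : Type u} [AddCommGroup M] [DistribMulAction G M] [TopologicalSpace M] [DiscreteTopology M]
  {H : Subgroup G}

omit [IsTopologicalGroup G] in
/-- The crossed-homomorphism identity on a subgroup, with the ambient action displayed.
[cite: SerreGaloisCohomology1997, Ch. I §5.1 (crossed homomorphisms)] -/
private theorem apply_mul' (z : contOneCocycles (discreteTopRep H M)) (a b : H) :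
    z.1 (a * b) = z.1 a + (a : G) • z.1 b :=
  z.2 a b

omit [IsTopologicalGroup G] in
/-- `a • z(a⁻¹) = -z(a)` for a crossed homomorphism. [cite: SerreGaloisCohomology1997, Ch. I §5.1] -/
private theorem smul_apply_inv (z : contOneCocycles (discreteTopRep H M)) (a : H) :
    (a : G) • z.1 a⁻¹ = -z.1 a := by
  have h := apply_mul' z a a⁻¹
  rw [mul_inv_cancel, contOneCocycles.apply_one] at h
  exact (neg_eq_of_add_eq_zero_right h.symm).symm

omit [IsTopologicalGroup G] in
/-- **Inner conjugation on a cocycle**: `h₀ • z(h₀⁻¹ τ h₀) = z(τ) + (τ • z(h₀) - z(h₀))`; in particular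
`= z(τ)` when `τ` acts trivially — inner automorphisms act trivially on `H¹`, at cocycle level.
[cite: SerreGaloisCohomology1997, Ch. I §5.1 and §2.5 (conjugation)] -/
private theorem smul_apply_conj (z : contOneCocycles (discreteTopRep H M)) (h₀ τ : H) :
    (h₀ : G) • z.1 (h₀⁻¹ * τ * h₀) = z.1 τ + ((τ : G) • z.1 h₀ - z.1 h₀) := by
  rw [apply_mul', apply_mul', smul_add, smul_add, smul_smul, smul_smul, smul_apply_inv]
  have e1 : ((h₀ : G) * ((h₀⁻¹ : H) : G)) = 1 := by rw [Subgroup.coe_inv, mul_inv_cancel]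
  have e2 : ((h₀ : G) * ((h₀⁻¹ * τ : H) : G)) = τ := by
    rw [Subgroup.coe_mul, Subgroup.coe_inv, mul_inv_cancel_left]
  rw [e1, one_smul, e2]
  abel

end Cocycle

/-! ## §2 Shadows of fine Selmer classes on `H′ = Λ₀ ∩ Gal(K̄/K_∞)` -/

section Shadow

variable {K : Type u} [Field K] {p : ℕ} [Fact p.Prime] (κ : ZpExtension K p)
  {M : Type u} [AddCommGroup M] [DistribMulAction (absoluteGaloisGroup K) M]
  [TopologicalSpace M] [DiscreteTopology M]
  (Λ₀ : Subgroup (absoluteGaloisGroup K))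

/-- **Shadows are additive on `H′`.**  If `f` agrees on `H′ = Λ₀ ∩ ker κ` with a cocycle `z` and `Λ₀` acts
trivially on `M`, then `f(ab) = f(a) + f(b)` on `H′` (the crossed term `a • z(b)` is `z(b)`).
[cite: CoatesSujatha2005, §3 proof of Thm. 3.4 (`H¹(L_∞, E[p]) = Hom(Gal(F̄/L_∞), E[p])`)] -/
theorem shadow_mul (htriv : ∀ σ ∈ Λ₀, ∀ m : M, σ • m = m) (f : absoluteGaloisGroup K → M)
    (z : contOneCocycles (discreteTopRep κ.kerSubgroup M))
    (hfz : ∀ τ : κ.kerSubgroup, (τ : absoluteGaloisGroup K) ∈ Λ₀ → f τ = z.1 τ)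
    {a b : absoluteGaloisGroup K} (ha : a ∈ Λ₀ ⊓ κ.kerSubgroup) (hb : b ∈ Λ₀ ⊓ κ.kerSubgroup) :
    f (a * b) = f a + f b := by
  obtain ⟨haΛ, haH⟩ := Subgroup.mem_inf.1 ha
  obtain ⟨hbΛ, hbH⟩ := Subgroup.mem_inf.1 hb
  have h := hfz (⟨a, haH⟩ * ⟨b, hbH⟩) (Λ₀.mul_mem haΛ hbΛ)
  rw [Subgroup.coe_mul] at h
  rw [h, apply_mul', hfz ⟨a, haH⟩ haΛ, hfz ⟨b, hbH⟩ hbΛ, htriv a haΛ]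

/-- **Sum of shadows.**  If `f`, `f′` are shadows of `c = [z]`, `c′ = [z′]` (vanishing off `H′`), then
`f + f′` is a shadow of `c + c′ = [z + z′]`. [cite: SerreGaloisCohomology1997, Ch. I §2.2 (additivity of classes)] -/
theorem shadow_add (f f' : absoluteGaloisGroup K → M)
    (z z' : contOneCocycles (discreteTopRep κ.kerSubgroup M))
    (hfz : ∀ τ : κ.kerSubgroup, (τ : absoluteGaloisGroup K) ∈ Λ₀ → f τ = z.1 τ)
    (hfz' : ∀ τ : κ.kerSubgroup, (τ : absoluteGaloisGroup K) ∈ Λ₀ → f' τ = z'.1 τ)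
    (hf : ∀ τ, τ ∉ Λ₀ ⊓ κ.kerSubgroup → f τ = 0) (hf' : ∀ τ, τ ∉ Λ₀ ⊓ κ.kerSubgroup → f' τ = 0) :
    (∀ τ : κ.kerSubgroup, (τ : absoluteGaloisGroup K) ∈ Λ₀ → (f + f') τ = (z + z').1 τ) ∧
      (∀ τ, τ ∉ Λ₀ ⊓ κ.kerSubgroup → (f + f') τ = 0) ∧
      oneCocycleClass _ (z + z') = oneCocycleClass _ z + oneCocycleClass _ z' := by
  refine ⟨fun τ hτ => ?_, fun τ hτ => ?_, oneCocycleClass_add _ z z'⟩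
  · rw [Pi.add_apply, hfz τ hτ, hfz' τ hτ]; rfl
  · rw [Pi.add_apply, hf τ hτ, hf' τ hτ, add_zero]

/-- **Negative of a shadow.** [cite: SerreGaloisCohomology1997, Ch. I §2.2] -/
theorem shadow_neg (f : absoluteGaloisGroup K → M)
    (z : contOneCocycles (discreteTopRep κ.kerSubgroup M))
    (hfz : ∀ τ : κ.kerSubgroup, (τ : absoluteGaloisGroup K) ∈ Λ₀ → f τ = z.1 τ)
    (hf : ∀ τ, τ ∉ Λ₀ ⊓ κ.kerSubgroup → f τ = 0) :
    (∀ τ : κ.kerSubgroup, (τ : absoluteGaloisGroup K) ∈ Λ₀ → (-f) τ = (-z).1 τ) ∧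
      (∀ τ, τ ∉ Λ₀ ⊓ κ.kerSubgroup → (-f) τ = 0) ∧
      oneCocycleClass _ (-z) = -oneCocycleClass _ z := by
  refine ⟨fun τ hτ => ?_, fun τ hτ => ?_, ?_⟩
  · rw [Pi.neg_apply, hfz τ hτ]; rfl
  · rw [Pi.neg_apply, hf τ hτ, neg_zero]
  · rw [eq_neg_iff_add_eq_zero, ← oneCocycleClass_add, neg_add_cancel]
    exact map_zero (oneCocycleClassₗ _)

/-- **Conjugate of a shadow.**  For `g ∈ Γ_K` and a shadow `f` of `c = [z]`, the function
`(g ⋆ f)(τ) = g • f(g⁻¹τg)` is a shadow of `conj_g c = [x ↦ g • z(g⁻¹xg)]` (the tree's `conjH1`, on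
cocycles by `map_oneCocycleClass`); `Λ₀` and `ker κ` being normal, `H′` is stable.
[cite: SerreGaloisCohomology1997, Ch. I §2.5 (conjugation on `H¹(H, M)`)] -/
theorem shadow_conj [Λ₀.Normal] (g : absoluteGaloisGroup K) (f : absoluteGaloisGroup K → M)
    (z : contOneCocycles (discreteTopRep κ.kerSubgroup M))
    (hfz : ∀ τ : κ.kerSubgroup, (τ : absoluteGaloisGroup K) ∈ Λ₀ → f τ = z.1 τ)
    (hf : ∀ τ, τ ∉ Λ₀ ⊓ κ.kerSubgroup → f τ = 0) :
    ∃ zg : contOneCocycles (discreteTopRep κ.kerSubgroup M),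
      oneCocycleClass _ zg = conjH1 κ.kerSubgroup M g (oneCocycleClass _ z) ∧
      (∀ τ : κ.kerSubgroup, (τ : absoluteGaloisGroup K) ∈ Λ₀ →
        (fun τ => g • f (g⁻¹ * τ * g)) τ = zg.1 τ) ∧
      (∀ τ, τ ∉ Λ₀ ⊓ κ.kerSubgroup → (fun τ => g • f (g⁻¹ * τ * g)) τ = 0) := by
  refine ⟨contOneCocycles.pullback (subgroupConj κ.kerSubgroup g)
    (resHomOfEquivariant (subgroupConj κ.kerSubgroup g) (DistribSMul.toAddMonoidHom M g)
      fun x m ↦ by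
        simp only [DistribSMul.toAddMonoidHom_apply, Subgroup.smul_def, subgroupConj_apply_coe,
          smul_smul, mul_assoc, mul_inv_cancel_left]) z, ?_, fun τ hτ => ?_, fun τ hτ => ?_⟩
  · rw [conjH1]
    exact (map_oneCocycleClass (X := discreteTopRep κ.kerSubgroup M)
      (Y := discreteTopRep κ.kerSubgroup M) _ _ z).symm
  · have hmem : g⁻¹ * (τ : absoluteGaloisGroup K) * g ∈ κ.kerSubgroup :=
      conj_mem_of_normal κ.kerSubgroup g τ
    have hΛ : g⁻¹ * (τ : absoluteGaloisGroup K) * g ∈ Λ₀ := by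
      simpa only [inv_inv] using (inferInstance : Λ₀.Normal).conj_mem _ hτ g⁻¹
    have h := hfz ⟨_, hmem⟩ hΛ
    change g • f (g⁻¹ * τ * g) = g • z.1 (subgroupConj κ.kerSubgroup g τ)
    rw [h]
    rfl
  · have hτ' : g⁻¹ * τ * g ∉ Λ₀ ⊓ κ.kerSubgroup := by
      intro h
      apply hτ
      have h2 := (inferInstance : (Λ₀ ⊓ κ.kerSubgroup).Normal).conj_mem _ h g
      simpa only [mul_assoc, mul_inv_cancel, mul_one, mul_inv_cancel_left] using h2
    change g • f (g⁻¹ * τ * g) = 0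
    rw [hf _ hτ', smul_zero]

/-- **`H = ker κ` acts trivially on shadows**: for `h₀ ∈ H`, `h₀ • f(h₀⁻¹τh₀) = f(τ)` — inner
automorphisms act trivially (`smul_apply_conj`; `Λ₀` acts trivially on `M`).
[cite: SerreGaloisCohomology1997, Ch. I §2.5 and §5.1] -/
theorem conj_eq_self_of_mem_ker [Λ₀.Normal] (htriv : ∀ σ ∈ Λ₀, ∀ m : M, σ • m = m)
    {h₀ : absoluteGaloisGroup K} (hh₀ : h₀ ∈ κ.kerSubgroup) (f : absoluteGaloisGroup K → M)
    (z : contOneCocycles (discreteTopRep κ.kerSubgroup M))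
    (hfz : ∀ τ : κ.kerSubgroup, (τ : absoluteGaloisGroup K) ∈ Λ₀ → f τ = z.1 τ)
    (hf : ∀ τ, τ ∉ Λ₀ ⊓ κ.kerSubgroup → f τ = 0) :
    (fun τ => h₀ • f (h₀⁻¹ * τ * h₀)) = f := by
  funext τ
  by_cases hτ : τ ∈ Λ₀ ⊓ κ.kerSubgroup
  · obtain ⟨hτΛ, hτH⟩ := Subgroup.mem_inf.1 hτ
    have hmem : h₀⁻¹ * τ * h₀ ∈ κ.kerSubgroup := conj_mem_of_normal κ.kerSubgroup h₀ ⟨τ, hτH⟩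
    have hΛ : h₀⁻¹ * τ * h₀ ∈ Λ₀ := by
      simpa only [inv_inv] using (inferInstance : Λ₀.Normal).conj_mem _ hτΛ h₀⁻¹
    have e : (⟨h₀⁻¹ * τ * h₀, hmem⟩ : κ.kerSubgroup) =
        (⟨h₀, hh₀⟩ : κ.kerSubgroup)⁻¹ * ⟨τ, hτH⟩ * ⟨h₀, hh₀⟩ := rfl
    change h₀ • f (h₀⁻¹ * τ * h₀) = f τ
    rw [hfz ⟨_, hmem⟩ hΛ, e, hfz ⟨τ, hτH⟩ hτΛ]
    have h := smul_apply_conj z ⟨h₀, hh₀⟩ ⟨τ, hτH⟩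
    have eτ : ((⟨τ, hτH⟩ : κ.kerSubgroup) : absoluteGaloisGroup K) = τ := rfl
    have eh : ((⟨h₀, hh₀⟩ : κ.kerSubgroup) : absoluteGaloisGroup K) = h₀ := rfl
    rw [eτ, eh, htriv τ hτΛ, sub_self, add_zero] at h
    exact h
  · have hτ' : h₀⁻¹ * τ * h₀ ∉ Λ₀ ⊓ κ.kerSubgroup := by
      intro h
      apply hτ
      have h2 := (inferInstance : (Λ₀ ⊓ κ.kerSubgroup).Normal).conj_mem _ h h₀
      simpa only [mul_assoc, mul_inv_cancel, mul_one, mul_inv_cancel_left] using h2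
    change h₀ • f (h₀⁻¹ * τ * h₀) = f τ
    rw [hf _ hτ', hf _ hτ, smul_zero]

/-- **Shadows of FINE classes kill every conjugate decomposition group.**  If `[z] ∈ Sel₀(K_∞, M)` and
`f` is its shadow, then `f(τ) = 0` for every `τ ∈ H′` with `g⁻¹τg ∈ D_v` (`v` a finite place,
`g ∈ Γ_K`): the fine condition at the place `g·v` of `K_∞` says `res_{H ∩ D_v}(conj_{g⁻¹}[z]) = 0`,
i.e. `g⁻¹ • z(τ) = (g⁻¹τg) • a - a = 0` as `g⁻¹τg ∈ Λ₀`.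
[cite: Greenberg1989, §1 p. 98 (the strict local conditions at all places of `ℚ_∞`)]
[cite: CoatesSujatha2005, §3 (definition of `R(E/F_∞)`; proof of Thm. 3.4)] -/
theorem shadow_eq_zero_of_conj_mem_decomp [NumberField K] [Λ₀.Normal]
    (htriv : ∀ σ ∈ Λ₀, ∀ m : M, σ • m = m)
    (f : absoluteGaloisGroup K → M) (z : contOneCocycles (discreteTopRep κ.kerSubgroup M))
    (hzS : oneCocycleClass _ z ∈ fineSelmerInfty M κ)
    (hfz : ∀ τ : κ.kerSubgroup, (τ : absoluteGaloisGroup K) ∈ Λ₀ → f τ = z.1 τ)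
    (v : HeightOneSpectrum (𝓞 K)) (g : absoluteGaloisGroup K) {τ : absoluteGaloisGroup K}
    (hτ : τ ∈ Λ₀ ⊓ κ.kerSubgroup) (hτv : g⁻¹ * τ * g ∈ decomp v) : f τ = 0 := by
  obtain ⟨hτΛ, hτH⟩ := Subgroup.mem_inf.1 hτ
  have hfine := ((FineSelmerCoefficientMap.mem_fineSelmerInfty_iff_resOfLe κ _).1 hzS).1 v g⁻¹
  rw [conjH1_oneCocycleClass_mem_ker_resOfLe_iff] at hfine
  obtain ⟨a, ha⟩ := hfine
  have hdH : g⁻¹ * τ * g ∈ κ.kerSubgroup := conj_mem_of_normal κ.kerSubgroup g ⟨τ, hτH⟩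
  have hdΛ : g⁻¹ * τ * g ∈ Λ₀ := by
    simpa only [inv_inv] using (inferInstance : Λ₀.Normal).conj_mem _ hτΛ g⁻¹
  have h := ha ⟨g⁻¹ * τ * g, Subgroup.mem_inf.2 ⟨hdH, hτv⟩⟩
  have ed : ((⟨g⁻¹ * τ * g, Subgroup.mem_inf.2 ⟨hdH, hτv⟩⟩ : ↥(κ.kerSubgroup ⊓ decomp v)) :
      absoluteGaloisGroup K) = g⁻¹ * τ * g := rfl
  rw [ed, htriv _ hdΛ, sub_self] at h
  -- the argument of `z` in `h` is `g (g⁻¹ τ g) g⁻¹ = τ`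
  have e : subgroupConj κ.kerSubgroup g⁻¹
      (Subgroup.inclusion (inf_le_left : κ.kerSubgroup ⊓ decomp v ≤ κ.kerSubgroup)
        ⟨g⁻¹ * τ * g, Subgroup.mem_inf.2 ⟨hdH, hτv⟩⟩) = ⟨τ, hτH⟩ := by
    apply Subtype.ext
    change g⁻¹⁻¹ * (g⁻¹ * τ * g) * g⁻¹ = τ
    group
  rw [e] at h
  rw [hfz ⟨τ, hτH⟩ hτΛ]
  exact (smul_eq_zero_iff_eq g⁻¹).1 h

/-- **Every shadow has an open stabiliser.**  For a shadow `f` of `[z]` there is an open normal subgroup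
`N ≤ Λ₀` of `Γ_K` with `u • f(u⁻¹τu) = f(τ)` for all `u ∈ N`: `z` is continuous into the discrete `M`,
so `{z = 0} ⊇ N ∩ H` for an open normal `N ≤ Λ₀` (profinite `Γ_K`), and then
`z(u⁻¹τu) = z(τ · [τ⁻¹u⁻¹τu]) = z(τ)`.  (This is the finite-orbit / direct-limit property of `H¹` of a
profinite group with discrete coefficients.) [cite: SerreGaloisCohomology1997, Ch. I §2.2 Prop. 8] -/
theorem exists_openNormal_conj_eq_self [Λ₀.Normal] (hΛ₀ : IsOpen (Λ₀ : Set (absoluteGaloisGroup K)))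
    (htriv : ∀ σ ∈ Λ₀, ∀ m : M, σ • m = m) (f : absoluteGaloisGroup K → M)
    (z : contOneCocycles (discreteTopRep κ.kerSubgroup M))
    (hfz : ∀ τ : κ.kerSubgroup, (τ : absoluteGaloisGroup K) ∈ Λ₀ → f τ = z.1 τ)
    (hf : ∀ τ, τ ∉ Λ₀ ⊓ κ.kerSubgroup → f τ = 0) :
    ∃ N : Subgroup (absoluteGaloisGroup K), N.Normal ∧ IsOpen (N : Set (absoluteGaloisGroup K)) ∧
      N ≤ Λ₀ ∧ ∀ u ∈ N, (fun τ => u • f (u⁻¹ * τ * u)) = f := by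
  haveI := absoluteGaloisGroup_compactSpace K
  -- `{z = 0}` is open in `H`, hence the trace of an open `O ⊆ Γ_K`
  have hz0 : IsOpen ((fun h : κ.kerSubgroup => z.1 h) ⁻¹' {0}) :=
    (isOpen_discrete _).preimage z.1.continuous
  obtain ⟨O, hO, hOeq⟩ := isOpen_induced_iff.1 hz0
  have h1O : (1 : absoluteGaloisGroup K) ∈ O := by
    have : (1 : κ.kerSubgroup) ∈ (fun h : κ.kerSubgroup => z.1 h) ⁻¹' {0} := by
      rw [Set.mem_preimage, Set.mem_singleton_iff]; exact contOneCocycles.apply_one z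
    rw [← hOeq] at this
    exact this
  obtain ⟨N, hN⟩ := ProfiniteGrp.exist_openNormalSubgroup_sub_open_nhds_of_one (hO.inter hΛ₀)
    ⟨h1O, Λ₀.one_mem⟩
  refine ⟨N, N.isNormal', N.isOpen', fun u hu => (hN hu).2, fun u hu => ?_⟩
  have huΛ : u ∈ Λ₀ := (hN hu).2
  funext τ
  by_cases hτ : τ ∈ Λ₀ ⊓ κ.kerSubgroup
  · obtain ⟨hτΛ, hτH⟩ := Subgroup.mem_inf.1 hτ
    have hmem : u⁻¹ * τ * u ∈ κ.kerSubgroup := conj_mem_of_normal κ.kerSubgroup u ⟨τ, hτH⟩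
    have hΛ : u⁻¹ * τ * u ∈ Λ₀ := by
      simpa only [inv_inv] using (inferInstance : Λ₀.Normal).conj_mem _ hτΛ u⁻¹
    -- the commutator `w = τ⁻¹ u⁻¹ τ u ∈ N ∩ H`, and `z w = 0`
    have hwN : τ⁻¹ * u⁻¹ * τ * u ∈ (N : Subgroup (absoluteGaloisGroup K)) := by
      have h1 : τ⁻¹ * u⁻¹ * τ⁻¹⁻¹ ∈ (N : Subgroup (absoluteGaloisGroup K)) :=
        N.isNormal'.conj_mem _ (N.toSubgroup.inv_mem hu) τ⁻¹
      rw [inv_inv] at h1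
      exact N.toSubgroup.mul_mem h1 hu
    have hwH : τ⁻¹ * u⁻¹ * τ * u ∈ κ.kerSubgroup := by
      have : τ⁻¹ * (u⁻¹ * τ * u) ∈ κ.kerSubgroup := κ.kerSubgroup.mul_mem (κ.kerSubgroup.inv_mem hτH) hmem
      simpa only [mul_assoc] using this
    have hzw : z.1 ⟨τ⁻¹ * u⁻¹ * τ * u, hwH⟩ = 0 := by
      have : (⟨τ⁻¹ * u⁻¹ * τ * u, hwH⟩ : κ.kerSubgroup) ∈
          (fun h : κ.kerSubgroup => z.1 h) ⁻¹' {0} := by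
        rw [← hOeq]; exact (hN hwN).1
      simpa using this
    have e : (⟨u⁻¹ * τ * u, hmem⟩ : κ.kerSubgroup) = ⟨τ, hτH⟩ * ⟨τ⁻¹ * u⁻¹ * τ * u, hwH⟩ := by
      apply Subtype.ext
      change u⁻¹ * τ * u = τ * (τ⁻¹ * u⁻¹ * τ * u)
      group
    change u • f (u⁻¹ * τ * u) = f τ
    rw [hfz ⟨_, hmem⟩ hΛ, e, apply_mul', hzw, smul_zero, add_zero, hfz ⟨τ, hτH⟩ hτΛ, htriv u huΛ]
  · have hτ' : u⁻¹ * τ * u ∉ Λ₀ ⊓ κ.kerSubgroup := by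
      intro h
      apply hτ
      have h2 := (inferInstance : (Λ₀ ⊓ κ.kerSubgroup).Normal).conj_mem _ h u
      simpa only [mul_assoc, mul_inv_cancel, mul_one, mul_inv_cancel_left] using h2
    change u • f (u⁻¹ * τ * u) = f τ
    rw [hf _ hτ', hf _ hτ, smul_zero]

end Shadow

/-! ## §3 Invisible classes are finitely many; a non-zero shadow exists -/

section Invisible

variable {K : Type u} [Field K] {p : ℕ} [Fact p.Prime] (κ : ZpExtension K p)
  {M : Type u} [AddCommGroup M] [DistribMulAction (absoluteGaloisGroup K) M]
  [TopologicalSpace M] [DiscreteTopology M]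
  (Λ₀ : Subgroup (absoluteGaloisGroup K))

/-- **The classes of `H¹(K_∞, M)` invisible on `H′` are finitely many** (`M` finite, `Λ₀` normal of
finite index): a cocycle `z` vanishing on `H′ = Λ₀ ∩ H` satisfies `z(hh′) = z(h)` for `h′ ∈ H′`, so it
is determined by finitely many values — this is the finiteness of the kernel
`H¹(Gal(L_∞/K_∞), M)` of `H¹(K_∞, M) → Hom(Gal(K̄/L_∞), M)`.
[cite: CoatesSujatha2005, §3 proof of Thm. 3.4 and Lemma 3.8 (finite kernel of restriction)] -/
theorem finite_setOf_invisible [Finite M] [Λ₀.Normal] [Λ₀.FiniteIndex] :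
    {c : subgroupH1 κ.kerSubgroup M | ∃ z : contOneCocycles (discreteTopRep κ.kerSubgroup M),
      oneCocycleClass _ z = c ∧
        ∀ τ : κ.kerSubgroup, (τ : absoluteGaloisGroup K) ∈ Λ₀ → z.1 τ = 0}.Finite := by
  -- the set of such cocycles injects into the functions on the finite `H / (Λ₀ ∩ H)`
  set N : Subgroup κ.kerSubgroup := Λ₀.subgroupOf κ.kerSubgroup with hN
  haveI : N.FiniteIndex := by
    refine ⟨?_⟩
    rw [hN]
    intro h0
    have hdvd : Λ₀.relIndex κ.kerSubgroup ∣ Λ₀.index :=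
      Subgroup.relIndex_dvd_index_of_normal Λ₀ κ.kerSubgroup
    rw [Subgroup.relIndex, h0, zero_dvd_iff] at hdvd
    exact Subgroup.FiniteIndex.index_ne_zero hdvd
  haveI : Finite (κ.kerSubgroup ⧸ N) := Subgroup.finite_quotient_of_finiteIndex
  let Z : Set (contOneCocycles (discreteTopRep κ.kerSubgroup M)) :=
    {z | ∀ τ : κ.kerSubgroup, (τ : absoluteGaloisGroup K) ∈ Λ₀ → z.1 τ = 0}
  have hZ : Z.Finite := by
    let F : Z → (κ.kerSubgroup ⧸ N → M) := fun z q => z.1.1 q.out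
    refine Set.finite_coe_iff.1 (Finite.of_injective F fun z₁ z₂ h12 => ?_)
    apply Subtype.ext; apply Subtype.ext
    ext x
    -- `z x = z (mk x).out` for `z ∈ Z`
    have key : ∀ z : Z, z.1.1 x = z.1.1 (QuotientGroup.mk (s := N) x).out := by
      intro z
      obtain ⟨n, hn⟩ := QuotientGroup.mk_out_eq_mul N x
      rw [hn, apply_mul', z.2 n (Subgroup.mem_subgroupOf.1 n.2), smul_zero, add_zero]
    rw [key z₁, key z₂]
    exact congrFun h12 _
  refine (hZ.image (oneCocycleClass _)).subset ?_
  rintro c ⟨z, rfl, hz⟩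
  exact ⟨z, hz, rfl⟩

/-- **If `Sel₀(K_∞, M)` is infinite, some fine class has a NON-ZERO shadow** (its cocycles do not vanish
identically on `H′ = Λ₀ ∩ ker κ`).  Contrapositive of `finite_setOf_invisible`: otherwise every fine
class would be invisible. [cite: CoatesSujatha2005, §3 proof of Thm. 3.4 (the image of `R(E[p]/F_∞)` in `Hom(Gal(F̄/L_∞), E[p])`)] -/
theorem exists_shadow_ne_zero [NumberField K] [Finite M] [Λ₀.Normal] [Λ₀.FiniteIndex]
    (hinf : (fineSelmerInfty M κ : Set (subgroupH1 κ.kerSubgroup M)).Infinite) :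
    ∃ (f : absoluteGaloisGroup K → M) (z : contOneCocycles (discreteTopRep κ.kerSubgroup M)),
      oneCocycleClass _ z ∈ fineSelmerInfty M κ ∧
      (∀ τ : κ.kerSubgroup, (τ : absoluteGaloisGroup K) ∈ Λ₀ → f τ = z.1 τ) ∧
      (∀ τ, τ ∉ Λ₀ ⊓ κ.kerSubgroup → f τ = 0) ∧ f ≠ 0 := by
  by_contra hcon
  apply hinf
  refine (finite_setOf_invisible κ Λ₀).subset fun c hc => ?_
  obtain ⟨z, rfl⟩ := oneCocycleClass_surjective _ c
  -- the shadow of `[z]`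
  let f : absoluteGaloisGroup K → M := fun τ =>
    if hτ : τ ∈ Λ₀ ⊓ κ.kerSubgroup then z.1 ⟨τ, (Subgroup.mem_inf.1 hτ).2⟩ else 0
  have hfz : ∀ τ : κ.kerSubgroup, (τ : absoluteGaloisGroup K) ∈ Λ₀ → f τ = z.1 τ := by
    intro τ hτ
    simp only [f, dif_pos (Subgroup.mem_inf.2 ⟨hτ, τ.2⟩)]
  have hf : ∀ τ, τ ∉ Λ₀ ⊓ κ.kerSubgroup → f τ = 0 := fun τ hτ => by simp only [f, dif_neg hτ]
  have h0 : f = 0 := by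
    by_contra hne
    exact hcon ⟨f, z, hc, hfz, hf, hne⟩
  refine ⟨z, rfl, fun τ hτ => ?_⟩
  rw [← hfz τ hτ, h0, Pi.zero_apply]

end Invisible

end Literature.NumberTheory.EllipticCurves.FineSelmerResidualCharacter

end
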